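import Summits.AnomalousDissipation.AnomalousDissipation.Theses.EnsembleRigidity
import Summits.AnomalousDissipation.AnomalousDissipation.Theorems.EnsembleRigidityGPStatisticalRigidityPartial
import Summits.AnomalousDissipation.AnomalousDissipation.Theorems.EnsembleRigidityGPStatisticalRigidityWeakDuality2
import HarnessLib

/-!
# Crux `EnsembleRigidity.GPStatisticalRigidity` (stmt-AnomalousDissipation-15508), line `Sketch` —
# THE REDUCTION: certificate family ⇒ crux

The composition of line `Sketch`, sorry-free, with its single open stub turned into an explicit
hypothesis. Write `CertFam(E)` for the Farkas-dual CERTIFICATE FAMILY of the Galloway–Proctor force at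
level `E` (registered open stub `stub_gpCertificateFamily2` of the crux): margins `γ, C > 0` and, for
every roughness scale `Λ > 0`, a cylindrical test functional `Ψ_Λ` and constants `a`, `b ≥ 0` with
`γ ≤ a − bE`, cost `‖∇Ψ_Λ'(v)‖² ≤ C²(1 + ‖∇v‖²)`, and the pointwise forced-Euler Lyapunov inequality
`a − b|v|² − Λ⁻¹(1 + ‖∇v‖²) ≤ ⟨f_GP − B(v,v), Ψ_Λ'(v)⟩` at every finite-enstrophy `v ∈ H`.

* `gpStatisticalRigidity_of_certificateFamily2` — if `CertFam(E)` holds at every level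
  `E ≥ 3/(4π)`, then `GPStatisticalRigidity` holds: below the second-moment horizon by the landed
  small-energy theorem (`gpStatisticalRigidity_smallEnergy`: cut-off removal + the test `w = f_GP`),
  above it by the landed weak duality with quadratic roughness allowance (`stub_weakDuality2`).
  This is the whole transfer of the line: the crux is REDUCED to the existence of the certificate
  families (conjecturally equivalent to it, by strong duality for generalised moment problems; open).
* `stub_gpReductionTools` — the registered tools stub recording the reduction.
-/

-- `Summit.<Summit>.<Problem>` is the tree's mandated summit-side namespace (CONVENTIONS §2); single-conjunct summit, duplicate deliberate.
set_option linter.dupNamespace false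

noncomputable section

namespace Summit.AnomalousDissipation.AnomalousDissipation.Theorems.EnsembleRigidity.GPStatisticalRigidity

open MeasureTheory Filter Topology UnitAddTorus
open scoped InnerProductSpace RealInnerProductSpace ENNReal NNReal
open Literature.Analysis.FunctionSpaces Literature.Analysis.FluidPDE
open Summit.AnomalousDissipation.AnomalousDissipation.Theorems.EnsembleRigidity

/-- Local notation: real vector fields on `T³`. -/
local notation "Vec3" => (UnitAddTorus (Fin 3)) → (EuclideanSpace ℝ (Fin 3))
/-- Local notation: `L²(T³; ℝ³)`. -/
local notation "L2" => (Lp (EuclideanSpace ℝ (Fin 3)) 2 (volume : Measure (UnitAddTorus (Fin 3))))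
/-- Local notation: the energy space `H`. -/
local notation "H3" => (Torus.energySpace (Fin 3))

/-- **The reduction of line `Sketch`: certificate families ⇒ statistical Lamb rigidity of `f_GP`.**
If for every level `E ≥ 3/(4π)` the Galloway–Proctor force admits a Farkas-dual family of
cylindrical forced-Euler Lyapunov certificates (margin `γ`, cost `C`, one certificate per roughness
scale `Λ`, quadratic roughness allowance `Λ⁻¹(1 + ‖∇v‖²)`), then the route declaration
`EnsembleRigidity.GPStatisticalRigidity` holds: for `E < 3/(4π)` by the landed small-energy theorem,
for `E ≥ 3/(4π)` by the landed weak duality `stub_weakDuality2` applied to the family. [folklore] -/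
theorem gpStatisticalRigidity_of_certificateFamily2
    (hC2 : ∀ f : Vec3, f = gpForce → ∀ E : ℝ, 3 / (4 * Real.pi) ≤ E →
      ∃ γ C : ℝ, 0 < γ ∧ 0 < C ∧ ∀ Λ : ℝ, 0 < Λ →
        ∃ (Ψ : Torus.CylindricalTest (Fin 3)) (a b : ℝ), 0 ≤ b ∧ γ ≤ a - b * E ∧
          (∀ v : H3, Torus.gradNormSq (Ψ.grad v) ≤
            C ^ 2 * (1 + (Torus.eGradNormSq ((v : L2) : Vec3)).toReal)) ∧
          (∀ v : H3, Torus.eGradNormSq ((v : L2) : Vec3) ≠ ⊤ →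
            a - b * ‖v‖ ^ 2 - Λ⁻¹ * (1 + (Torus.eGradNormSq ((v : L2) : Vec3)).toReal) ≤
              Torus.nsGeneratorPairing 0 f v (Ψ.grad v))) :
    Summit.AnomalousDissipation.AnomalousDissipation.Theses.EnsembleRigidity.GPStatisticalRigidity := by
  intro f hf E
  by_cases hE : E < 3 / (4 * Real.pi)
  · exact gpStatisticalRigidity_smallEnergy f hf E hE
  · have hf' : f = gpForce := hf.trans gpForce_eq.symm
    obtain ⟨γ, C, hγ, hC, hfam⟩ := hC2 f hf' E (le_of_not_gt hE)
    obtain ⟨c, δ₀, hc, hδ₀, hrig⟩ := stub_weakDuality2 f E γ C hγ hC hfam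
    exact ⟨c, δ₀, hc, hδ₀, fun μ hμ hint hEμ hG _hshell R hR0 hRδ hdef =>
      hrig μ hμ hint hEμ hG R hR0 hRδ hdef⟩

/-- **Tools stub `stub_gpReductionTools`** (registered on stmt-AnomalousDissipation-15508): the crux
`GPStatisticalRigidity` follows from the certificate families `stub_gpCertificateFamily2` at all levels
`E ≥ 3/(4π)` (line `Sketch`, reduction). [folklore] -/
theorem stub_gpReductionTools :
    (∀ f : Vec3, f = gpForce → ∀ E : ℝ, 3 / (4 * Real.pi) ≤ E →
      ∃ γ C : ℝ, 0 < γ ∧ 0 < C ∧ ∀ Λ : ℝ, 0 < Λ →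
        ∃ (Ψ : Torus.CylindricalTest (Fin 3)) (a b : ℝ), 0 ≤ b ∧ γ ≤ a - b * E ∧
          (∀ v : H3, Torus.gradNormSq (Ψ.grad v) ≤
            C ^ 2 * (1 + (Torus.eGradNormSq ((v : L2) : Vec3)).toReal)) ∧
          (∀ v : H3, Torus.eGradNormSq ((v : L2) : Vec3) ≠ ⊤ →
            a - b * ‖v‖ ^ 2 - Λ⁻¹ * (1 + (Torus.eGradNormSq ((v : L2) : Vec3)).toReal) ≤
              Torus.nsGeneratorPairing 0 f v (Ψ.grad v))) →
    Summit.AnomalousDissipation.AnomalousDissipation.Theses.EnsembleRigidity.GPStatisticalRigidity :=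
  gpStatisticalRigidity_of_certificateFamily2

end Summit.AnomalousDissipation.AnomalousDissipation.Theorems.EnsembleRigidity.GPStatisticalRigidity

end
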